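import Summits.AtomisticToContinuum.Crystallization.Theorems.ChartedZeroExcessLayeredLatticeLiouvilleZZZYRCXR
import Summits.AtomisticToContinuum.Crystallization.Theorems.ChartedZeroExcessLayeredLatticeLiouvilleZZZYRCZU

/-!
# ChartedZeroExcessLayeredLatticeLiouville · ZZZYRCXRI — THE IN HALF OF THE WINDOWED KERNEL CONTRACT (`KernelSlabSoundIn` from one residue)
(decomp-a2c hand-1 g55; target stmt-AtomisticToContinuum-26636 JS-D near reader, line (D) item 5c; critic r1872 (B) «hand-1 OWES on the In side
exactly (E1) `c.1.1.2 = r` (rfl-level) and (E2) `PiecesWithin r H₀ c` for EVERY path node — `layersWithin` checks only the far layer … ADOPTED: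
one more decided Bool `nodesWithin r MB cs` over all codes of each chord folded into hslab + its soundness»; lens-2 RCZU `KernelSlabSoundIn`)

§1 the decided all-nodes check `nodesWithin mX MB cs` (EVERY node code of every chord has shifted layer within `MB` of `600 + mX`), its
soundness `piecesWithin_of_nodesWithin` (⇒ lens-2's `PiecesWithin mX MB (decodeChord mX c)`: both endpoints of every piece, the base included)
and `layersWithin_of_nodesWithin` (the far code is a node code).  §2 ★★★ `kernelSlabSoundIn_of_residue`: the tree assembly
`kernelSlabSoundW_of_residue` (ZZZYRCXR) at `r = MB = H₀` with `nodesWithin H₀ H₀` in place of `layersWithin` concludes lens-2's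
`KernelSlabSoundIn H₀ (wordZ w) lo hi P9 E (residueData H₀ cuts cs) (residueTR cuts T) (residueTN cuts T)` VERBATIM — (E1) is `rfl` on
`decodeChord`, (E2) is §1.  The window type's K-file thus proves `KernelSlabSoundIn` by `decide`/`rfl` on its slabs and ONE application of §2;
lens-2's `kernelSlabSoundF_of_in_out` / `_of_in` (RCZU §3) take it from there.  Imports RCXR + RCZU; 0 sorry.  All `[folklore]`.
-/

namespace Summit.AtomisticToContinuum.Crystallization.Theorems.ChartedZeroExcessLayeredLatticeLiouville.ThetaKernel

open scoped BigOperators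

/-! ## §1 the decided all-nodes check and `PiecesWithin` -/

/-- the per-code test: shifted layer `y % 1201` within `MB` of the shifted base layer `600 + mX`. -/
def codeWithin (mX MB y : ℕ) : Bool := Nat.ble (600 + mX) (y % 1201 + MB) && Nat.ble (y % 1201) (600 + mX + MB)

/-- DECIDED SIDE CONDITION of a window slab (r1872 (B) (E2)): EVERY node code of every chord passes `codeWithin` (not only the far one,
cf. `layersWithin`). -/
def nodesWithin (mX MB : ℕ) (cs : List (List ℕ)) : Bool := cs.all fun c => c.all (codeWithin mX MB)

/-- a code passing the test decodes to a site whose layer is within `MB` of `mX`. [folklore] -/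
theorem abs_layer_siteN_le {mX MB y : ℕ} (h : codeWithin mX MB y = true) : |(siteN (dec3 y)).2 - (mX : ℤ)| ≤ MB := by
  unfold codeWithin at h
  rw [Bool.and_eq_true, Nat.ble_eq, Nat.ble_eq] at h
  have hy : (siteN (dec3 y)).2 = ((y % 1201 : ℕ) : ℤ) - 600 := rfl
  rw [hy, abs_le]
  constructor <;> push_cast <;> omega

/-- `nodesWithin` implies `layersWithin` for nonempty chords (the far code is the last node code). [folklore] -/
theorem layersWithin_of_nodesWithin {mX MB : ℕ} {cs : List (List ℕ)} (hne : ∀ c ∈ cs, c ≠ []) (h : nodesWithin mX MB cs = true) :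
    layersWithin mX MB cs = true := by
  unfold nodesWithin at h
  unfold layersWithin
  rw [List.all_eq_true] at h ⊢
  intro c hc
  have hy := List.all_eq_true.mp (h c hc) _ (lastD_mem c 0 (hne c hc))
  unfold codeWithin at hy
  exact hy

/-- ★ SOUNDNESS OF `nodesWithin` (r1872 (B) (E2)): both endpoints of every piece of the decoded chord lie within `MB` layers of the base
layer `mX` — lens-2's `PiecesWithin (mX : ℤ) MB (decodeChord mX c)`. [folklore] -/
theorem piecesWithin_of_nodesWithin {mX MB : ℕ} {cs : List (List ℕ)} (hne : ∀ c ∈ cs, c ≠ []) (h : nodesWithin mX MB cs = true) :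
    ∀ c ∈ cs, PiecesWithin (mX : ℤ) MB (decodeChord mX c) := by
  intro c hc i _
  unfold nodesWithin at h
  have hall : ∀ y ∈ c, codeWithin mX MB y = true := List.all_eq_true.mp (List.all_eq_true.mp h c hc)
  have hlast : |(siteN (dec3 (lastD c 0))).2 - (mX : ℤ)| ≤ MB := abs_layer_siteN_le (hall _ (lastD_mem c 0 (hne c hc)))
  have hnode : ∀ j, |(siteN ((c.map dec3).getD j (dec3 (lastD c 0)))).2 - (mX : ℤ)| ≤ MB := by
    intro j
    rw [List.getD_eq_getElem?_getD, List.getElem?_map]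
    rcases hj : (getElem? c j : Option ℕ) with _ | y
    · exact hlast
    · exact abs_layer_siteN_le (hall y (List.mem_of_getElem? hj))
  rw [chordPiece_decodeChord mX (hne c hc) i, liftN]
  refine ⟨?_, hnode i⟩
  cases i with
  | zero =>
    rw [List.getD_cons_zero, siteN_chordX]
    simp
  | succ j => rw [List.getD_cons_succ]; exact hnode j

/-! ## §2 the In half of the windowed contract -/

/-- ★★★ THE IN HALF FOR ONE WINDOW TYPE (r1869 (C) §3 / RCZU `KernelSlabSoundIn`; r1872 (B) (E1)(E2)): the residue assembly of ZZZYRCXR at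
`r = MB = H₀` — word `w` (the window letters `win ++ [0]`, `|w| ∣ 612`), ONE sorted cut list from `lo` to `hi`, per window a certified slab, its
count certificate, strictly increasing far codes and the decided all-nodes check `nodesWithin H₀ H₀` — proves lens-2's `KernelSlabSoundIn`
for the decoded data and the summed integer tables of this residue, verbatim. [folklore] -/
theorem kernelSlabSoundIn_of_residue (w : List ℕ) (P9 E H₀ GB lo hi : ℕ) (cuts : List ℕ) (t0 : ℕ → PT) (cs : ℕ → List (List ℕ))
    (T : ℕ → List (ℕ × ℕ × ℕ)) (hw2 : ∀ n ∈ w, n ≤ 2) (hp : w.length ∣ 612) (hr : H₀ < w.length) (hr1 : H₀ < 601) (hP9 : P9 ≤ 2000000)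
    (hhi : hi < 2160000) (hGB : 4 * hi < 3 * (3 * GB + 1) ^ 2) (hlen : 2 ≤ cuts.length) (hsort : cuts.Pairwise (· < ·))
    (hc0 : cuts.getD 0 0 = lo) (hcL : cuts.getD (cuts.length - 1) 0 = hi)
    (hslab : ∀ s, s + 1 < cuts.length → slabAcc w P9 E H₀ (cuts.getD s 0) (cuts.getD (s + 1) 0) (t0 s) (cs s) = some (T s) ∧
      lastCodesStrict (cs s) = true ∧ (cs s).length = (countWins w H₀ GB H₀ cuts).getD s 0 ∧ nodesWithin H₀ H₀ (cs s) = true) :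
    KernelSlabSoundIn H₀ (wordZ w) lo hi P9 E (residueData H₀ cuts cs) (residueTR cuts T) (residueTN cuts T) := by
  have hw := regN_le_two hw2 w.length
  have hne : ∀ s, s + 1 < cuts.length → ∀ c ∈ cs s, c ≠ [] := by
    intro s hs c hc
    obtain ⟨H1, -, -⟩ := slabAcc_sound w P9 E H₀ hw hr1 _ _ (t0 s) (cs s) (T s) (hslab s hs).1
    have hle : ((cuts.getD (s + 1) 0 : ℕ) : ℤ) ≤ (hi : ℤ) := by
      rw [← hcL]; exact_mod_cast getD_mono_of_sorted hsort (by omega) (by omega)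
    exact ne_nil_of_window (lt_of_le_of_lt hle (by exact_mod_cast hhi)) (H1 c hc).2.1
  obtain ⟨hV, hD, hC, hT⟩ := kernelSlabSoundW_of_residue w P9 E H₀ GB H₀ lo hi cuts t0 cs T hw2 hp hr hr1 hP9 (by omega) hhi hGB hlen
    hsort hc0 hcL fun s hs => ⟨(hslab s hs).1, (hslab s hs).2.1, (hslab s hs).2.2.1, layersWithin_of_nodesWithin (hne s hs) (hslab s hs).2.2.2⟩
  unfold KernelSlabSoundIn
  refine ⟨fun c hc => ?_, hD, hC, hT⟩
  obtain ⟨h1, -, -, h4, h5, h6⟩ := hV c hc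
  unfold residueData at hc
  obtain ⟨s, hs, hc'⟩ := List.mem_flatMap.mp hc
  rw [List.mem_range] at hs
  obtain ⟨d, hd, rfl⟩ := List.mem_map.mp hc'
  exact ⟨h1, rfl, piecesWithin_of_nodesWithin (hne s (by omega)) (hslab s (by omega)).2.2.2 d hd, h4, h5, h6⟩


/-! ## §3 the word of record: the window type's own `2H₀ + 1` letters (congruence of the In half in the word) -/

/-- ★ CONGRUENCE: the In half depends on the word only through its letters on the window `0 … 2H₀` (chords are centre-based with every
node in the window): two words longer than `2H₀` agreeing there carry the same `KernelSlabSoundIn`. [folklore] -/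
theorem kernelSlabSoundIn_congr {H₀ : ℕ} {wd₁ wd₂ : List ℤ} {lo hi P9max : ℤ} {E : ℕ} {cd : List ChordDatum}
    {TRz TNz : ℤ × ℤ × ℤ × ℤ → ℤ} (hp₁ : 2 * (H₀ : ℤ) < (wd₁.length : ℤ)) (hp₂ : 2 * (H₀ : ℤ) < (wd₂.length : ℤ))
    (hag : ∀ j : ℤ, 0 ≤ j → j ≤ 2 * (H₀ : ℤ) → regW wd₁ j = regW wd₂ j) (h : KernelSlabSoundIn H₀ wd₁ lo hi P9max E cd TRz TNz) :
    KernelSlabSoundIn H₀ wd₂ lo hi P9max E cd TRz TNz := by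
  have hℓ₂ : AgreesOnWindow H₀ wd₂ (regW wd₁) := fun j h0 h1 => hag j h0 h1
  have hℓ₁ : AgreesOnWindow H₀ wd₁ (regW wd₁) := fun _ _ _ => rfl
  obtain ⟨hV, hD, hC, hT⟩ := h
  have hch : ∀ c ∈ cd, n9W wd₂ c.1 = n9W wd₁ c.1 ∧ ∀ i < chordNp c, n9W wd₂ (chordPiece c i) = n9W wd₁ (chordPiece c i) := by
    intro c hc
    obtain ⟨-, hb, hw, -⟩ := hV c hc
    obtain ⟨hn, hpc⟩ := inChord_letters hp₂ hℓ₂ hb hw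
    exact ⟨by rw [← hn]; rfl, fun i hi => by rw [← (hpc i hi).1]; rfl⟩
  have hcd₁ : ∀ c ∈ cd, c.1.1.2 = (H₀ : ℤ) ∧ PiecesWithin H₀ H₀ c ∧ lo < n9W wd₁ c.1 ∧ n9W wd₁ c.1 ≤ hi := fun c hc =>
    ⟨(hV c hc).2.1, (hV c hc).2.2.1, (hV c hc).2.2.2.1, (hV c hc).2.2.2.2.1⟩
  have hcd₂ : ∀ c ∈ cd, c.1.1.2 = (H₀ : ℤ) ∧ PiecesWithin H₀ H₀ c ∧ lo < n9W wd₂ c.1 ∧ n9W wd₂ c.1 ≤ hi := fun c hc => by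
    rw [(hch c hc).1]; exact hcd₁ c hc
  refine ⟨fun c hc => ?_, hD, fun y hy hlo hhi => ?_, fun k => ?_⟩
  · obtain ⟨h0, hb, hw, hlo, hhi, h6⟩ := hV c hc
    obtain ⟨e1, ep⟩ := hch c hc
    refine ⟨h0, hb, hw, by rw [e1]; exact hlo, by rw [e1]; exact hhi, fun i hi => ?_⟩
    rw [ep i hi]; exact h6 i hi
  · have hy' := abs_le.mp hy
    have e : n9W wd₂ (((0 : Cell 2), (H₀ : ℤ)), y) = n9W wd₁ (((0 : Cell 2), (H₀ : ℤ)), y) := by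
      have h := n9F_eq_of_letters (ℓ := regW wd₂) (ℓ' := regW wd₁) (x := (((0 : Cell 2), (H₀ : ℤ)), y))
        (hag _ (by positivity) (by push_cast; omega)).symm (hag _ (by simp only; omega) (by simp only; omega)).symm
      exact h
    rw [e] at hlo hhi
    exact hC y hy hlo hhi
  · have h1 := thetaG_eq_of_in hp₁ hℓ₁ hcd₁ k
    have h2 := thetaG_eq_of_in hp₂ hℓ₂ hcd₂ k
    rw [← h2.1, ← h2.2, h1.1, h1.2]
    exact hT k

/-- the periodic letter of a word at a layer inside it is the plain entry. [folklore] -/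
theorem regW_eq_getD {wd : List ℤ} {j : ℤ} (h0 : 0 ≤ j) (hj : j < (wd.length : ℤ)) : regW wd j = wd.getD j.toNat 0 := by
  unfold regW; rw [Int.emod_eq_of_lt h0 hj]

/-- the kernel's padded word `win ++ [0]` and the window type's own word `win` agree on the window letters. [folklore] -/
theorem regW_wordZ_pad (win : List ℕ) {j : ℤ} (h0 : 0 ≤ j) (hj : j < (win.length : ℤ)) :
    regW (wordZ (win ++ [0])) j = regW (wordZ win) j := by
  have hl1 : (wordZ (win ++ [0])).length = win.length + 1 := by rw [length_wordZ, List.length_append, List.length_singleton]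
  have hl2 : (wordZ win).length = win.length := length_wordZ win
  rw [regW_eq_getD h0 (by rw [hl1]; push_cast; omega), regW_eq_getD h0 (by rw [hl2]; exact hj)]
  have hjn : j.toNat < win.length := by have := Int.toNat_of_nonneg h0; omega
  unfold wordZ
  rw [List.map_append, List.getD_append _ _ _ _ (by rw [List.length_map]; exact hjn)]

/-- ★★★ THE IN HALF IN THE WORD OF RECORD (lens-2 RCZW: the reader consumes `KernelSlabSoundF H₀ R (windowWord ℓ (m − H₀) (2H₀+1))`,
a word of `2H₀ + 1` letters): run the periodic kernel on the PADDED word `win ++ [0]` (its period `2H₀ + 2` divides `612` for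
`H₀ ∈ {2, 5, 8, 16}`; the pad letter is never read since every node is in the window), conclude for `wordZ win` itself. [folklore] -/
theorem kernelSlabSoundIn_of_window (win : List ℕ) (P9 E H₀ GB lo hi : ℕ) (cuts : List ℕ) (t0 : ℕ → PT) (cs : ℕ → List (List ℕ))
    (T : ℕ → List (ℕ × ℕ × ℕ)) (hw2 : ∀ n ∈ win, n ≤ 2) (hwl : win.length = 2 * H₀ + 1) (hp : (win.length + 1) ∣ 612)
    (hr1 : H₀ < 601) (hP9 : P9 ≤ 2000000) (hhi : hi < 2160000) (hGB : 4 * hi < 3 * (3 * GB + 1) ^ 2) (hlen : 2 ≤ cuts.length)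
    (hsort : cuts.Pairwise (· < ·)) (hc0 : cuts.getD 0 0 = lo) (hcL : cuts.getD (cuts.length - 1) 0 = hi)
    (hslab : ∀ s, s + 1 < cuts.length →
      slabAcc (win ++ [0]) P9 E H₀ (cuts.getD s 0) (cuts.getD (s + 1) 0) (t0 s) (cs s) = some (T s) ∧ lastCodesStrict (cs s) = true ∧
        (cs s).length = (countWins (win ++ [0]) H₀ GB H₀ cuts).getD s 0 ∧ nodesWithin H₀ H₀ (cs s) = true) :
    KernelSlabSoundIn H₀ (wordZ win) lo hi P9 E (residueData H₀ cuts cs) (residueTR cuts T) (residueTN cuts T) := by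
  have hl : (win ++ [0]).length = win.length + 1 := by rw [List.length_append, List.length_singleton]
  have h := kernelSlabSoundIn_of_residue (win ++ [0]) P9 E H₀ GB lo hi cuts t0 cs T
    (fun n hn => by
      rcases List.mem_append.mp hn with hn | hn
      · exact hw2 n hn
      · rw [List.mem_singleton] at hn; omega)
    (by rw [hl]; exact hp) (by rw [hl]; omega) hr1 hP9 hhi hGB hlen hsort hc0 hcL hslab
  refine kernelSlabSoundIn_congr (by rw [length_wordZ, hl]; push_cast; omega) (by rw [length_wordZ]; omega)
    (fun j h0 h1 => regW_wordZ_pad win h0 (by omega)) h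

end Summit.AtomisticToContinuum.Crystallization.Theorems.ChartedZeroExcessLayeredLatticeLiouville.ThetaKernel
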